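import Literature.Analysis.Asymptotics.LaplaceMethodMultivariate
import HarnessLib

/-!
# Route `SwapVirialDeficit` (YangMills): the GAUSSIAN FLOOR of a quadratic-form integral — `∫_V e^{−Q/2} ≥ (2π/Λ)^{m/2}` when `λ‖y‖² ≤ Q(y) ≤ Λ‖y‖²`,
# and its logarithmic form (the generic half of stub S4b: a QUANTITATIVE floor `𝔐₀ ≥ e^{−K·L^k}` on the Morse–Bott main constant)

LEAD ym-line-sfw-p2 g97 (cell ym-idea-1, free hands; `--supports stmt-QuantumFields-24197`; generic, model-free).  Referee finding (F1) on fcl-p3 g47's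
➍ skeleton (2026-08-31T17:52Z): the window arithmetic must absorb two ABSOLUTE exponentially small terms into `b^{−θ}·(2π/b)^α·𝔐₀` (`α = 9L⁴ − 1`), which
needs `log 𝔐₀ ≥ −K·L^k`.  The main constant is `𝔐₀ = K_L·Σ∫∫ ρ(η₀)·(2π)^{−α}·∫_V e^{−½Q}`, `Q(y) = D²F̂(η₀)[ξy, ξy]`; the second-derivative jets
(fcl-p3 g47 ✓`taylor_four_gnoDeficit_line_norm`: `|ψ″| ≤ 20400L⁴S²`) bound `Q(y) ≤ Λ‖y‖²` with `Λ = poly(L)`, so the fibre factor is `≥ (2π/Λ)^{α}` i.e.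
`(2π)^{−α}∫e^{−½Q} ≥ Λ^{−α} = e^{−α log Λ}` — polynomial×log in `L`.  This file is the generic inequality:

* ★ `gaussian_floor_of_le` — `V` a finite-dimensional real inner-product space, `Q` measurable with `λ‖y‖² ≤ Q y ≤ Λ‖y‖²` (`0 < λ`, `0 < Λ`):
  `(2π/Λ)^{finrank V/2} ≤ ∫ y, exp(−Q y/2)` (and the integrand is integrable);
* ★ `normalised_gaussian_floor_of_le` — `Λ^{−finrank V/2} ≤ (2π)^{−finrank V/2}·∫ y, exp(−Q y/2)`;
* `log_normalised_gaussian_floor_of_le` — `−(finrank V/2)·log Λ ≤ log((2π)^{−finrank V/2}·∫ e^{−Q/2})`.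

HONEST LABEL: elementary (theorems only, 0 `def`, 0 `sorry`, standard axioms); the model-side S4b (`e^{−KL^k} ≤ mbConst L`) needs in addition the explicit
`K_L`, the density floor `ρ(η₀) ≥ (1+V₀²)^{−4}` on a base square and positive cone mass of a bulk hub set — g47's Defs file first.  ⟨24197⟩ ∕ ⟨24194⟩ OPEN;
⟨24196⟩ proved; own crux ⟨22884⟩ OPEN (blocked-on ⟨19935⟩); the Yang–Mills mass gap is NOT proved; no summit is proved by a line.
References: [cite: Breitung1994, Lemma 39 p. 55]; [folklore].
-/

set_option autoImplicit false

noncomputable section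

open _root_.MeasureTheory _root_.Set _root_.Module
open scoped _root_.Real _root_.InnerProductSpace

namespace Summit.QuantumFields.YangMills.Theorems.QuantitativeLaplace

variable {V : Type*} [NormedAddCommGroup V] [InnerProductSpace ℝ V] [FiniteDimensional ℝ V]
  [MeasurableSpace V] [BorelSpace V]

/-- ★ **Gaussian floor.**  If `Q : V → ℝ` is measurable with `λ‖y‖² ≤ Q y ≤ Λ‖y‖²` for all `y` (`λ, Λ > 0`), then `y ↦ e^{−Q y/2}` is integrable and
`(2π/Λ)^{m/2} ≤ ∫ e^{−Q/2}`, `m = finrank ℝ V` (compare with the round Gaussian `e^{−Λ‖y‖²/2}`, whose integral is `(π/(Λ/2))^{m/2}`).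
[cite: Breitung1994, Lemma 39 p. 55] -/
theorem gaussian_floor_of_le {Q : V → ℝ} (hQm : Measurable Q) {lam Λ : ℝ} (hlam : 0 < lam) (hΛ : 0 < Λ)
    (hlo : ∀ y : V, lam * ‖y‖ ^ 2 ≤ Q y) (hhi : ∀ y : V, Q y ≤ Λ * ‖y‖ ^ 2) :
    Integrable (fun y : V => Real.exp (-(Q y / 2))) ∧
    (2 * π / Λ) ^ ((finrank ℝ V : ℝ) / 2) ≤ ∫ y : V, Real.exp (-(Q y / 2)) := by
  -- integrability by domination with `e^{−(λ/2)‖y‖²}`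
  have hmeas : AEStronglyMeasurable (fun y : V => Real.exp (-(Q y / 2))) volume :=
    (Real.measurable_exp.comp (hQm.div_const 2).neg).aestronglyMeasurable
  have hint : Integrable (fun y : V => Real.exp (-(Q y / 2))) := by
    refine (Literature.Analysis.Asymptotics.integrable_exp_neg_mul_norm_sq (V := V) (c := lam / 2) (by positivity)).mono hmeas
      (Filter.Eventually.of_forall fun y => ?_)
    rw [Real.norm_eq_abs, Real.norm_eq_abs, abs_of_pos (Real.exp_pos _), abs_of_pos (Real.exp_pos _), Real.exp_le_exp]
    have := hlo y
    linarith
  refine ⟨hint, ?_⟩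
  -- comparison with the round Gaussian of rate `Λ/2`
  have hg := GaussianFourier.integral_rexp_neg_mul_sq_norm (V := V) (b := Λ / 2) (by positivity)
  have hgint := Literature.Analysis.Asymptotics.integrable_exp_neg_mul_norm_sq (V := V) (c := Λ / 2) (by positivity)
  have e : (2 * π / Λ : ℝ) = π / (Λ / 2) := by field_simp
  rw [e, ← hg]
  refine integral_mono hgint hint fun y => ?_
  dsimp only
  rw [Real.exp_le_exp]
  have := hhi y
  linarith

/-- ★ **Normalised Gaussian floor**: under the same hypotheses `Λ^{−m/2} ≤ (2π)^{−m/2}·∫ e^{−Q/2}` — the fibre factor of a Morse–Bott density is at least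
`Λ^{−m/2}` when the Hessian form is `≤ Λ‖·‖²`. [cite: Breitung1994, Lemma 39 p. 55] -/
theorem normalised_gaussian_floor_of_le {Q : V → ℝ} (hQm : Measurable Q) {lam Λ : ℝ} (hlam : 0 < lam) (hΛ : 0 < Λ)
    (hlo : ∀ y : V, lam * ‖y‖ ^ 2 ≤ Q y) (hhi : ∀ y : V, Q y ≤ Λ * ‖y‖ ^ 2) :
    Λ ^ (-((finrank ℝ V : ℝ) / 2)) ≤ ((2 * π) ^ ((finrank ℝ V : ℝ) / 2))⁻¹ * ∫ y : V, Real.exp (-(Q y / 2)) := by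
  obtain ⟨-, h⟩ := gaussian_floor_of_le hQm hlam hΛ hlo hhi
  have h2π : (0 : ℝ) < 2 * π := by positivity
  have hsplit : (2 * π / Λ) ^ ((finrank ℝ V : ℝ) / 2) = (2 * π) ^ ((finrank ℝ V : ℝ) / 2) * Λ ^ (-((finrank ℝ V : ℝ) / 2)) := by
    rw [Real.div_rpow h2π.le hΛ.le, Real.rpow_neg hΛ.le, div_eq_mul_inv]
  rw [hsplit] at h
  have hpow : (0 : ℝ) < (2 * π) ^ ((finrank ℝ V : ℝ) / 2) := Real.rpow_pos_of_pos h2π _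
  rw [inv_mul_eq_div, le_div_iff₀' hpow]
  exact h

/-- **Logarithmic form**: `−(m/2)·log Λ ≤ log((2π)^{−m/2}·∫ e^{−Q/2})` — the shape a window-arithmetic consumer wants (`log 𝔐 ≥ −poly`). [folklore] -/
theorem log_normalised_gaussian_floor_of_le {Q : V → ℝ} (hQm : Measurable Q) {lam Λ : ℝ} (hlam : 0 < lam) (hΛ : 0 < Λ)
    (hlo : ∀ y : V, lam * ‖y‖ ^ 2 ≤ Q y) (hhi : ∀ y : V, Q y ≤ Λ * ‖y‖ ^ 2) :
    -((finrank ℝ V : ℝ) / 2) * Real.log Λ ≤ Real.log (((2 * π) ^ ((finrank ℝ V : ℝ) / 2))⁻¹ * ∫ y : V, Real.exp (-(Q y / 2))) := by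
  have h := normalised_gaussian_floor_of_le hQm hlam hΛ hlo hhi
  have hpos : 0 < Λ ^ (-((finrank ℝ V : ℝ) / 2)) := Real.rpow_pos_of_pos hΛ _
  have hlog := Real.log_le_log hpos h
  rwa [Real.log_rpow hΛ] at hlog

end Summit.QuantumFields.YangMills.Theorems.QuantitativeLaplace

end
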